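import Summits.HodgeConjecture.HodgeConjecture.Theorems.TropicalWeilObstructionTropicalWeilVanishingFrameSpanAnyPeriod
import HarnessLib

/-!
# Route `TropicalWeilObstruction` (Kontsevich's tropical test — NEGATION SINK, exploration, no summit claim):
# the frame span of an effective tropical `4`-cycle — VI. the `θ₄`-coefficient of a non-empty cycle

Negation-sink bookkeeping of the cell `pub-hodge-tropical` (seat tropical-1 gen 6); part VI (parts I–V:
`…FrameSpan{Master,WeilPlane,Rank,Seeds,AnyPeriod}`). Part V bounds the frame span of an effective tropical `4`-cycle
whose class has a representation `cyc Z = q₀ θ₄(Q) + q₁ Re w(Q) + q₂ Im w(Q)` with `q₀ ≠ 0`, at ANY period `Q` (`det Q ≠ 0`,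
`QJ = JQ`). This file removes the hypothesis `q₀ ≠ 0` for non-empty cycles:

* `sum_sum_mul_cyc_eq`, `sum_sum_mul_cyc_nonneg` — the cycle class is a positive combination of squares:
  `Σ_{t,r} v_t v_r cyc Z(I_t,I_r) = Σ_σ w_σ a_σ (Σ_t v_t p_σ(I_t))² ≥ 0` for every family of words;
* `sum_reOmega_mul_omega` — `Σ_r Re Ω(I_r) Ω(I_r) = 8`, `Σ_r Im Ω(I_r) Ω(I_r) = 8i` on the `70` increasing words;
* `thetaCoeff_ne_zero_of_repr` — if `Z` has a cell then `q₀ ≠ 0`: with `q₀ = 0` the class would be `Re(ζ Ω ⊗ Ω)`,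
  `ζ = (q₁ - iq₂) det M_Q`, whose values on `Re Ω̂, Im Ω̂, Re Ω̂ ± Im Ω̂` are `64 Re ζ, -64 Re ζ, ∓128 Im ζ`; positivity
  forces `ζ = 0`, i.e. `cyc Z = 0`, impossible for a non-empty effective cycle;
* `frameSpan_of_mem_threeSpace` — hence, hypothesis-free: a NON-EMPTY effective tropical `4`-cycle on `ℝ⁸/Qℤ⁸` whose
  class lies in K3's `3`-space `⟨θ₄(Q), Re w(Q), Im w(Q)⟩` has Plücker vectors spanning `≥ 69` of the `70` dimensions of
  `⋀⁴ℝ⁸`, `≥ 69` pairwise distinct Plücker vectors and `≥ 69` cells. At `Q = 1`: a design on `≤ 68` rational `4`-planes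
  (e.g. the `64`-plane character design of idea card `identity-seeds`) is never "(A)-passing".

HONEST STATUS. Linear algebra; decides nothing about K1 (`TropicalWeilVanishing`, open) or the Hodge conjecture.
No definition, no named fact, no sorry.

References: [Zharkov2020TropicalWeil] I. Zharkov, arXiv:2002.02347, §2 (pp. 2–4); [MikhalkinZharkov2014Eigenwave]
G. Mikhalkin, I. Zharkov, LN UMI 15 (2014), Def. 4.2, Prop. 4.3, Thm. 5.4.
-/

set_option linter.dupNamespace false

noncomputable section

open scoped BigOperators
open Matrix
open Literature.AlgebraicGeometry.Tropical
open Summit.HodgeConjecture.HodgeConjecture.Theorems.TropicalHodgeBound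

namespace Summit.HodgeConjecture.HodgeConjecture.Theorems.TropicalWeilVanishing.FrameSpan

/-! ## §0 Display-only notation (the K3 skeleton's local definitions, verbatim bodies; nothing is defined) -/

/-- `P = [1 | i·1]`, the `n × 2n` matrix of `dz₁ ∧ … ∧ dz_n`. -/
local notation3 (prettyPrint := false) "𝐏⟦" n "⟧" =>
  (Matrix.of fun (k : Fin n) (a : Fin (2 * n)) =>
    (if (a : ℕ) = (k : ℕ) then (1 : ℂ) else 0) + (if (a : ℕ) = (k : ℕ) + n then Complex.I else 0))

/-- The skeleton's `thetaClass n Q`. -/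
local notation3 (prettyPrint := false) "θ⟦" n "⟧" Q:max =>
  (fun S S' : Fin n → Fin (2 * n) => Matrix.det (Matrix.submatrix Q S S'))

/-- The skeleton's `omegaFrame n` (`Ω = Pᴴ`). -/
local notation3 (prettyPrint := false) "Ω⟦" n "⟧" =>
  (Matrix.of fun (a : Fin (2 * n)) (b : Fin n) =>
    (if (a : ℕ) = (b : ℕ) then (1 : ℂ) else 0) - (if (a : ℕ) = (b : ℕ) + n then Complex.I else 0))

/-- The skeleton's `weilClassC n Q` (`w(Q) = (⋀ⁿQ ⊗ 1)(Ω ⊗ Ω)`). -/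
local notation3 (prettyPrint := false) "wC⟦" n "⟧" Q:max =>
  (fun S S' : Fin n → Fin (2 * n) =>
    Matrix.det (Matrix.submatrix (Matrix.map Q ((↑) : ℝ → ℂ) * Ω⟦n⟧) S id) *
      Matrix.det (Matrix.submatrix (Ω⟦n⟧) S' id))

/-- The skeleton's `weilClassRe n Q` (`w₁ = Re w`). -/
local notation3 (prettyPrint := false) "wRe⟦" n "⟧" Q:max =>
  (fun S S' : Fin n → Fin (2 * n) => Complex.re ((wC⟦n⟧ Q) S S'))

/-- The skeleton's `weilClassIm n Q` (`w₂ = Im w`). -/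
local notation3 (prettyPrint := false) "wIm⟦" n "⟧" Q:max =>
  (fun S S' : Fin n → Fin (2 * n) => Complex.im ((wC⟦n⟧ Q) S S'))

/-- `M_Q := ½ · P Q Pᴴ`, the matrix of `Q|_{V^{1,0}}` in the frame `Ω` (`QΩ = Ω M_Q`). Nothing is defined. -/
local notation3 (prettyPrint := false) "𝐌⟦" n "⟧" Q:max =>
  ((2 : ℂ)⁻¹ • (𝐏⟦n⟧ * Matrix.map Q ((↑) : ℝ → ℂ) * (𝐏⟦n⟧)ᴴ))

/-- NEW display-only notation: the `Ω`-minor `Ω(S) := det Ω⟦4⟧[S,·] ∈ ℤ[i]` of a word `S` (the value of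
`dz̄₁ ∧ dz̄₂ ∧ dz̄₃ ∧ dz̄₄` on `e_S`). Nothing is defined. -/
local notation3 (prettyPrint := false) "Ωm" S:max => (Matrix.det (Matrix.submatrix (Ω⟦4⟧) S id))

/-! ## §1 Positivity of the cycle class on a family of words -/

/-- The cycle class is a positive combination of squares: for any family of words `I` and real coefficients `v`,
`Σ_{t,r} v_t v_r cyc Z(I_t,I_r) = Σ_σ w_σ a_σ (Σ_t v_t p_σ(I_t))²`. [cite: MikhalkinZharkov2014Eigenwave, Prop. 4.3] -/
theorem sum_sum_mul_cyc_eq {g p : ℕ} {Q : Matrix (Fin g) (Fin g) ℝ} (Z : TropicalTorusCycle g p Q)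
    {ι : Type*} [Fintype ι] (I : ι → (Fin p → Fin g)) (v : ι → ℝ) :
    ∑ t, ∑ r, v t * v r * TropicalTorusCycle.cyc Z (I t) (I r) =
      ∑ σ, ((Z.cell σ).weight : ℝ) * (Z.cell σ).latticeVolume *
        (∑ t, v t * ((pluckerCoord (Z.cell σ).frame (I t) : ℤ) : ℝ)) ^ 2 := by
  unfold TropicalTorusCycle.cyc
  calc ∑ t, ∑ r, v t * v r * ∑ σ, ((Z.cell σ).weight : ℝ) * (Z.cell σ).latticeVolume *
          ((pluckerCoord (Z.cell σ).frame (I t) : ℤ) : ℝ) * ((pluckerCoord (Z.cell σ).frame (I r) : ℤ) : ℝ)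
      = ∑ t, ∑ r, ∑ σ, v t * v r * (((Z.cell σ).weight : ℝ) * (Z.cell σ).latticeVolume *
          ((pluckerCoord (Z.cell σ).frame (I t) : ℤ) : ℝ) * ((pluckerCoord (Z.cell σ).frame (I r) : ℤ) : ℝ)) := by
        simp_rw [Finset.mul_sum]
    _ = ∑ t, ∑ σ, ∑ r, v t * v r * (((Z.cell σ).weight : ℝ) * (Z.cell σ).latticeVolume *
          ((pluckerCoord (Z.cell σ).frame (I t) : ℤ) : ℝ) * ((pluckerCoord (Z.cell σ).frame (I r) : ℤ) : ℝ)) :=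
        Finset.sum_congr rfl fun t _ => Finset.sum_comm
    _ = ∑ σ, ∑ t, ∑ r, v t * v r * (((Z.cell σ).weight : ℝ) * (Z.cell σ).latticeVolume *
          ((pluckerCoord (Z.cell σ).frame (I t) : ℤ) : ℝ) * ((pluckerCoord (Z.cell σ).frame (I r) : ℤ) : ℝ)) :=
        Finset.sum_comm
    _ = _ := by
        refine Finset.sum_congr rfl fun σ _ => ?_
        rw [sq, Finset.sum_mul_sum, Finset.mul_sum]
        refine Finset.sum_congr rfl fun t _ => ?_
        rw [Finset.mul_sum]
        exact Finset.sum_congr rfl fun r _ => by ring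

/-- Hence `Σ_{t,r} v_t v_r cyc Z(I_t,I_r) ≥ 0`. [cite: MikhalkinZharkov2014Eigenwave, Prop. 4.3] -/
theorem sum_sum_mul_cyc_nonneg {g p : ℕ} {Q : Matrix (Fin g) (Fin g) ℝ} (Z : TropicalTorusCycle g p Q)
    {ι : Type*} [Fintype ι] (I : ι → (Fin p → Fin g)) (v : ι → ℝ) :
    0 ≤ ∑ t, ∑ r, v t * v r * TropicalTorusCycle.cyc Z (I t) (I r) := by
  rw [sum_sum_mul_cyc_eq]
  exact Finset.sum_nonneg fun σ _ =>
    mul_nonneg (mul_nonneg (Nat.cast_nonneg _) (latticeVolume_pos _).le) (sq_nonneg _)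

/-! ## §2 The `θ₄`-coefficient of a non-empty effective cycle is non-zero (any period) -/

/-- `Σ_r Re Ω(I_r) · Ω(I_r) = 8` and `Σ_r Im Ω(I_r) · Ω(I_r) = 8i` over the increasing words (from `Σ Ω² = 0`, `Σ |Ω|² = 16`).
[folklore] -/
theorem sum_reOmega_mul_omega :
    (∑ r : Fin 70, (((Ωm (Chk.wordOfRank r)).re : ℝ) : ℂ) * Ωm (Chk.wordOfRank r)) = 8 ∧
      (∑ r : Fin 70, (((Ωm (Chk.wordOfRank r)).im : ℝ) : ℂ) * Ωm (Chk.wordOfRank r)) = 8 * Complex.I := by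
  have hP := sum_omega_sq
  have hN := sum_omega_mul_conj
  constructor
  · have e : ∀ r : Fin 70, (((Ωm (Chk.wordOfRank r)).re : ℝ) : ℂ) * Ωm (Chk.wordOfRank r) =
        (1 / 2) * (Ωm (Chk.wordOfRank r) * Ωm (Chk.wordOfRank r) +
          Ωm (Chk.wordOfRank r) * (starRingEnd ℂ) (Ωm (Chk.wordOfRank r))) := by
      intro r; rw [Complex.re_eq_add_conj]; ring
    simp_rw [e]
    rw [← Finset.mul_sum, Finset.sum_add_distrib, hP, hN]
    norm_num
  · have e : ∀ r : Fin 70, (((Ωm (Chk.wordOfRank r)).im : ℝ) : ℂ) * Ωm (Chk.wordOfRank r) =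
        (Complex.I / 2) * (Ωm (Chk.wordOfRank r) * (starRingEnd ℂ) (Ωm (Chk.wordOfRank r)) -
          Ωm (Chk.wordOfRank r) * Ωm (Chk.wordOfRank r)) := by
      intro r
      rw [Complex.im_eq_sub_conj]
      have hI : Complex.I ≠ 0 := Complex.I_ne_zero
      field_simp
      ring_nf
      rw [Complex.I_sq]
      ring
    simp_rw [e]
    rw [← Finset.mul_sum, Finset.sum_sub_distrib, hP, hN]
    ring

/-- **The `θ₄`-coefficient of a NON-EMPTY effective cycle is non-zero (any period).** If `det Q ≠ 0`, `QJ = JQ` and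
`cyc Z = q₀θ₄(Q) + q₁Re w(Q) + q₂Im w(Q)` for an effective tropical `4`-cycle `Z` with a cell, then `q₀ ≠ 0`: otherwise
`cyc Z = Re(ζ Ω ⊗ Ω)` (`ζ = (q₁ - iq₂) det M_Q`) would be a non-zero positive combination of squares, but on the increasing
words its values on `Re Ω̂`, `Im Ω̂`, `Re Ω̂ ± Im Ω̂` are `64 Re ζ`, `-64 Re ζ`, `∓128 Im ζ`, forcing `ζ = 0`.
[cite: Zharkov2020TropicalWeil, §2] [cite: MikhalkinZharkov2014Eigenwave, Prop. 4.3 and Thm. 5.4] -/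
theorem thetaCoeff_ne_zero_of_repr {Q : Matrix (Fin (2 * 4)) (Fin (2 * 4)) ℝ} (hQd : IsUnit Q.det)
    (hJ : Q * weilJ 4 = weilJ 4 * Q) (Z : TropicalTorusCycle (2 * 4) 4 Q) (hZ : 0 < Z.numCells) (q0 q1 q2 : ℝ)
    (hq : TropicalTorusCycle.cyc Z = q0 • θ⟦4⟧ Q + q1 • wRe⟦4⟧ Q + q2 • wIm⟦4⟧ Q) : q0 ≠ 0 := by
  intro h0
  obtain ⟨hR, hM⟩ := sum_reOmega_mul_omega
  set Ωv : Fin 70 → ℂ := fun r => Ωm (Chk.wordOfRank r) with hΩv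
  set m : ℂ := (𝐌⟦4⟧ Q).det with hm
  set ζ : ℂ := ((q1 : ℂ) - Complex.I * (q2 : ℂ)) * m with hζ
  have hm0 : m ≠ 0 := by
    intro hm0'
    have h1 := det_M_mul_det_M_inv Q hQd hJ
    rw [← hm, hm0', zero_mul] at h1
    exact zero_ne_one h1
  -- the table on increasing words
  have hC : ∀ t r : Fin 70, TropicalTorusCycle.cyc Z (Chk.wordOfRank t) (Chk.wordOfRank r) = (ζ * Ωv t * Ωv r).re := by
    intro t r
    have hSS : TropicalTorusCycle.cyc Z (Chk.wordOfRank t) (Chk.wordOfRank r) =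
        q1 * ((wC⟦4⟧ Q) (Chk.wordOfRank t) (Chk.wordOfRank r)).re +
          q2 * ((wC⟦4⟧ Q) (Chk.wordOfRank t) (Chk.wordOfRank r)).im := by
      rw [hq, h0]; simp only [Pi.add_apply, Pi.smul_apply, smul_eq_mul, zero_mul, zero_add]
    rw [hSS, re_combo, weilClassC_eq_det_mul Q hJ]
    congr 1
    rw [hζ]
    ring
  -- quadratic form identity
  have hquad : ∀ v : Fin 70 → ℝ, ∑ t, ∑ r, v t * v r * TropicalTorusCycle.cyc Z (Chk.wordOfRank t) (Chk.wordOfRank r) =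
      (ζ * (∑ t, ((v t : ℝ) : ℂ) * Ωv t) ^ 2).re := by
    intro v
    simp_rw [hC]
    rw [sq, Finset.sum_mul_sum, Finset.mul_sum, Complex.re_sum]
    refine Finset.sum_congr rfl fun t _ => ?_
    rw [Finset.mul_sum, Complex.re_sum]
    refine Finset.sum_congr rfl fun r _ => ?_
    rw [show ζ * (((v t : ℝ) : ℂ) * Ωv t * (((v r : ℝ) : ℂ) * Ωv r)) = (((v t * v r : ℝ) : ℝ) : ℂ) * (ζ * Ωv t * Ωv r) by
      push_cast; ring, Complex.re_ofReal_mul]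
  have hRv : (∑ t, (((fun t : Fin 70 => (Ωv t).re) t : ℝ) : ℂ) * Ωv t) = 8 := hR
  have hMv : (∑ t, (((fun t : Fin 70 => (Ωv t).im) t : ℝ) : ℂ) * Ωv t) = 8 * Complex.I := hM
  have hPv : (∑ t, (((fun t : Fin 70 => (Ωv t).re + (Ωv t).im) t : ℝ) : ℂ) * Ωv t) = 8 + 8 * Complex.I := by
    have e : (∑ t, (((fun t : Fin 70 => (Ωv t).re + (Ωv t).im) t : ℝ) : ℂ) * Ωv t) =
        (∑ t, (((Ωv t).re : ℝ) : ℂ) * Ωv t) + ∑ t, (((Ωv t).im : ℝ) : ℂ) * Ωv t := by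
      rw [← Finset.sum_add_distrib]
      exact Finset.sum_congr rfl fun t _ => by push_cast; ring
    rw [e, hR, hM]
  have hDv : (∑ t, (((fun t : Fin 70 => (Ωv t).re - (Ωv t).im) t : ℝ) : ℂ) * Ωv t) = 8 - 8 * Complex.I := by
    have e : (∑ t, (((fun t : Fin 70 => (Ωv t).re - (Ωv t).im) t : ℝ) : ℂ) * Ωv t) =
        (∑ t, (((Ωv t).re : ℝ) : ℂ) * Ωv t) - ∑ t, (((Ωv t).im : ℝ) : ℂ) * Ωv t := by
      rw [← Finset.sum_sub_distrib]
      exact Finset.sum_congr rfl fun t _ => by push_cast; ring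
    rw [e, hR, hM]
  have n1 := sum_sum_mul_cyc_nonneg Z (fun r : Fin 70 => Chk.wordOfRank r) (fun t => (Ωv t).re)
  have n2 := sum_sum_mul_cyc_nonneg Z (fun r : Fin 70 => Chk.wordOfRank r) (fun t => (Ωv t).im)
  have n3 := sum_sum_mul_cyc_nonneg Z (fun r : Fin 70 => Chk.wordOfRank r) (fun t => (Ωv t).re + (Ωv t).im)
  have n4 := sum_sum_mul_cyc_nonneg Z (fun r : Fin 70 => Chk.wordOfRank r) (fun t => (Ωv t).re - (Ωv t).im)
  rw [hquad, hRv] at n1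
  rw [hquad, hMv] at n2
  rw [hquad, hPv] at n3
  rw [hquad, hDv] at n4
  have sq1 : ((8 : ℂ)) ^ 2 = ((64 : ℝ) : ℂ) := by norm_num
  have sq2 : (8 * Complex.I) ^ 2 = ((-64 : ℝ) : ℂ) := by
    rw [mul_pow, Complex.I_sq]; norm_num
  have sq3 : (8 + 8 * Complex.I) ^ 2 = ((128 : ℝ) : ℂ) * Complex.I := by
    have : (8 + 8 * Complex.I) ^ 2 = 64 + 128 * Complex.I + 64 * Complex.I ^ 2 := by ring
    rw [this, Complex.I_sq]; push_cast; ring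
  have sq4 : (8 - 8 * Complex.I) ^ 2 = ((-128 : ℝ) : ℂ) * Complex.I := by
    have : (8 - 8 * Complex.I) ^ 2 = 64 - 128 * Complex.I + 64 * Complex.I ^ 2 := by ring
    rw [this, Complex.I_sq]; push_cast; ring
  have reA : ∀ a : ℝ, (ζ * ((a : ℝ) : ℂ)).re = a * ζ.re := by
    intro a; rw [mul_comm, Complex.re_ofReal_mul]
  have reB : ∀ a : ℝ, (ζ * (((a : ℝ) : ℂ) * Complex.I)).re = -a * ζ.im := by
    intro a
    rw [show ζ * (((a : ℝ) : ℂ) * Complex.I) = ((a : ℝ) : ℂ) * (ζ * Complex.I) by ring, Complex.re_ofReal_mul,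
      Complex.mul_I_re]
    ring
  have e1 : (ζ * (8 : ℂ) ^ 2).re = 64 * ζ.re := by rw [sq1, reA]
  have e2 : (ζ * (8 * Complex.I) ^ 2).re = -64 * ζ.re := by rw [sq2, reA]
  have e3 : (ζ * (8 + 8 * Complex.I) ^ 2).re = -128 * ζ.im := by rw [sq3, reB]
  have e4 : (ζ * (8 - 8 * Complex.I) ^ 2).re = 128 * ζ.im := by rw [sq4, reB]; ring
  rw [e1] at n1; rw [e2] at n2; rw [e3] at n3; rw [e4] at n4
  have hre : ζ.re = 0 := by linarith
  have him : ζ.im = 0 := by linarith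
  have hζ0 : ζ = 0 := Complex.ext hre him
  have hq12 : ((q1 : ℂ) - Complex.I * (q2 : ℂ)) = 0 := (mul_eq_zero.mp (hζ ▸ hζ0)).resolve_right hm0
  have hq1 : q1 = 0 := by have := congrArg Complex.re hq12; simpa using this
  have hq2 : q2 = 0 := by have := congrArg Complex.im hq12; simpa using this
  refine cyc_ne_zero Z hZ ?_
  rw [hq, h0, hq1, hq2, zero_smul, zero_smul, zero_smul, add_zero, add_zero]

/-- **FRAME SPAN AT ANY PERIOD, hypothesis-free form:** a NON-EMPTY effective tropical `4`-cycle on `ℝ⁸/Qℤ⁸` (`det Q ≠ 0`,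
`QJ = JQ`) whose class lies in K3's `3`-space, `cyc Z = q₀θ₄(Q) + q₁Re w(Q) + q₂Im w(Q)`, has Plücker vectors spanning `≥ 69`
dimensions, `≥ 69` pairwise distinct Plücker vectors and `≥ 69` cells. At `Q = 1`: no design on `≤ 68` rational `4`-planes has
its class in `⟨θ₄(1), Re w(1), Im w(1)⟩` (it is not "(A)-passing"). [cite: Zharkov2020TropicalWeil, §2]
[cite: MikhalkinZharkov2014Eigenwave, Def. 4.2 and Prop. 4.3] -/
theorem frameSpan_of_mem_threeSpace {Q : Matrix (Fin (2 * 4)) (Fin (2 * 4)) ℝ} (hQd : IsUnit Q.det)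
    (hJ : Q * weilJ 4 = weilJ 4 * Q) (Z : TropicalTorusCycle (2 * 4) 4 Q) (hZ : 0 < Z.numCells) (q0 q1 q2 : ℝ)
    (hq : TropicalTorusCycle.cyc Z = q0 • θ⟦4⟧ Q + q1 • wRe⟦4⟧ Q + q2 • wIm⟦4⟧ Q) :
    69 ≤ Module.finrank ℝ (Submodule.span ℝ (Set.range fun σ : Fin Z.numCells =>
        fun S : Fin 4 → Fin (2 * 4) => ((pluckerCoord (Z.cell σ).frame S : ℤ) : ℝ))) ∧
      69 ≤ (Finset.univ.image fun σ : Fin Z.numCells => pluckerCoord (Z.cell σ).frame).card ∧ 69 ≤ Z.numCells := by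
  have hq0 := thetaCoeff_ne_zero_of_repr hQd hJ Z hZ q0 q1 q2 hq
  exact ⟨finrank_span_frames_ge_of_repr hQd hJ Z q0 q1 q2 hq hq0,
    card_image_pluckerCoord_ge_of_repr hQd hJ Z q0 q1 q2 hq hq0⟩


end Summit.HodgeConjecture.HodgeConjecture.Theorems.TropicalWeilVanishing.FrameSpan

end
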